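import Summits.Ventures.PercRepro.ProfilePointedCircuitClassesStarStarA
import Summits.Ventures.PercRepro.ProfilePointedCircuitClassesStarStarB
import Summits.Ventures.PercRepro.ProfilePointedCircuitClassesStarStarD

/-!
# PercRepro — THE SPANNING `5`-SETS OF `S ∪ Y` IN A RANK-`4` MATROID, V: THE COUNT
(p5, gen 41; `proofs/P5-GM1.md` §60)

**THEOREM** (`one_add_three_mul_card_le_card_spanning_five`): in a loopless matroid of rank `4`, for a spanning
`5`-set `S` and a set `Y` of at least three further points,
`1 + 3·#Y + 3·ι₂(Y) + ι₃(Y) ≤ #{X ∈ C(S ∪ Y, 5) : X spans}`, `ι_j(Y)` the independent `j`-subsets of `Y`.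

Proof.  The labels of part I give `σ₅ ≥ 1 + Σ_y a(y) + Σ_{C(Y,2)} g + Σ_{C(Y,3)} g`, with `g ≥ 3` on independent
pairs and `g ≥ 4` on independent triples.  If `S` has no parallel pair, every `y` has `a(y) ≥ 3` (part II) and
the count closes (`..._of_no_parallel_pair`).  If `S` has a parallel pair `{s₁, s₂}` (part III), let `P` be the BAD
points of `Y` (parallel to `s₁`), `b := #P`: `Σ_y a(y) ≥ 3#Y − b`, and `Σ_{C(Y,2)} g ≥ 3ι₂ + C(b, 2)` (the bad pairs are
dependent with `g ≥ 1`).  `b ≥ 3`: `C(b,2) ≥ b`.  `b = 2`: a non-bad `y` (there is one, `#Y ≥ 3`) gives the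
dependent triple `{z, z', y}` with `g ≥ 1` (part IV).  `b = 1`: two non-bad `y ≠ y'`; if some non-bad `w` misses two
of the hyperplanes `Π_m`, the independent pair `{z, w}` has `g ≥ 5`; otherwise `y, y'` lie on lines `cl{s₁, m}`,
`cl{s₁, m'}` — one line: the dependent triple `{z, y, y'}` has `g ≥ 1`; two lines: the independent pair `{y, y'}`
has `g ≥ 4` (`..._of_parallel_pair`).
-/

open scoped Matroid

namespace PercRepro.Cogirth

open Finset ThmH Skew Shadow Profile

variable {α : Type} [DecidableEq α] {M : Matroid α} [M.Finite]

section StarStarE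

/-- The label sum expanded: `Σ_{k<4} Σ_{C(Y,k)} g = 1 + Σ_y a(y) + Σ_{C(Y,2)} g + Σ_{C(Y,3)} g`. -/
theorem sum_range_four_eq {S Y : Finset α} (hSsp : rk M S = 4) :
    (∑ k ∈ range 4, ∑ Z ∈ Y.powersetCard k,
        ((S.powersetCard k).filter (fun A => rk M ((S \ A) ∪ Z) = 4)).card) =
      1 + (∑ y ∈ Y, (S.filter (fun s => rk M (insert y (S.erase s)) = 4)).card) +
        (∑ Z ∈ Y.powersetCard 2, ((S.powersetCard 2).filter (fun A => rk M ((S \ A) ∪ Z) = 4)).card) +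
        (∑ Z ∈ Y.powersetCard 3, ((S.powersetCard 3).filter (fun A => rk M ((S \ A) ∪ Z) = 4)).card) := by
  rw [sum_range_succ, sum_range_succ, sum_range_succ, sum_range_one,
    sum_powersetCard_zero_eq_one hSsp, sum_powersetCard_one_eq]

/-- **The count when `S` has no parallel pair**: every point has three labels. -/
theorem one_add_three_mul_card_le_card_spanning_five_of_no_parallel_pair (hR : rk M (gr M) = 4)
    {S Y : Finset α} (hS : S ⊆ gr M) (hS5 : S.card = 5) (hSsp : rk M S = 4) (hY : Y ⊆ gr M \ S)
    (hnp : ¬ ∃ t ∈ S, ∃ t' ∈ S, t ≠ t' ∧ rk M {t, t'} ≤ 1) :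
    1 + 3 * Y.card + 3 * ((Y.powersetCard 2).filter (fun Z => rk M Z = 2)).card +
      ((Y.powersetCard 3).filter (fun Z => rk M Z = 3)).card ≤
      (((S ∪ Y).powersetCard 5).filter (fun X => rk M X = 4)).card := by
  have hSY : Disjoint S Y := by
    rw [disjoint_left]
    intro x hxS hxY
    exact (mem_sdiff.1 (hY hxY)).2 hxS
  have hsum := sum_card_filter_le_card_spanning_five (M := M) hS5 hSY
  rw [sum_range_four_eq hSsp] at hsum
  have h1 := three_mul_card_le_sum_one (M := M) (S := S) (Y := Y) (fun y hy => by
    rcases three_le_card_filter_or_exists_parallel_pair hR hS hS5 hSsp (M := M)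
      (mem_sdiff.1 (hY hy)).1 (mem_sdiff.1 (hY hy)).2 with h | h
    · exact h
    · exact absurd h hnp)
  have h2 := three_mul_card_filter_le_sum_two hR hS hS5 hSsp hY
  have h3 := card_filter_le_sum_three hR hS hS5 hSsp hY
  omega

/-- `K + {z, y}` spans for a bad `z` and any `y`. -/
theorem rk_sdiff_pair_union_pair_eq_four (hR : rk M (gr M) = 4) (hll : ∀ x ∈ gr M, rk M {x} = 1)
    {S : Finset α} (hS : S ⊆ gr M) (hSsp : rk M S = 4) {s₁ s₂ : α} (hs₁ : s₁ ∈ S) (hs₂ : s₂ ∈ S)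
    (hpar : rk M {s₁, s₂} ≤ 1) {z y : α} (hz : z ∈ gr M) (hy : y ∈ gr M) (hzb : rk M {s₁, z} ≤ 1) :
    rk M ((S \ {s₁, s₂}) ∪ {z, y}) = 4 := by
  have hKg : S \ {s₁, s₂} ⊆ gr M := sdiff_subset.trans hS
  have hsub : insert z (insert y (S \ {s₁, s₂})) ⊆ (S \ {s₁, s₂}) ∪ {z, y} := by
    intro x hx
    rw [mem_insert, mem_insert] at hx
    rw [mem_union, mem_insert, mem_singleton]
    rcases hx with h | h | h
    · exact Or.inr (Or.inl h)
    · exact Or.inr (Or.inr h)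
    · exact Or.inl h
  have h1 := rk_mono' (M := M) hsub
  have h2 := rk_insert_eq_of_parallel hll hz (hS hs₁) (by rw [pair_comm]; exact hzb)
    (X := insert y (S \ {s₁, s₂})) (insert_subset hy hKg)
  rw [insert_comm s₁ y] at h2
  have h3 := rk_mono' (M := M) (subset_insert y (insert s₁ (S \ {s₁, s₂})))
  have h4 := rk_insert_sdiff_pair_eq_four hR hll hS hSsp hs₁ hs₂ hpar
  have h5 : rk M ((S \ {s₁, s₂}) ∪ {z, y}) ≤ rk M (gr M) :=
    rk_le_rk_gr (union_subset hKg (insert_subset hz (singleton_subset_iff.2 hy)))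
  omega

/-- A bad `z` and a non-bad `y` form an independent pair: `ρ{z, y} = ρ{s₁, y} = 2`. -/
theorem rk_pair_eq_two_of_bad_of_not (hll : ∀ x ∈ gr M, rk M {x} = 1) {s₁ z y : α} (hs₁ : s₁ ∈ gr M)
    (hz : z ∈ gr M) (hy : y ∈ gr M) (hzb : rk M {s₁, z} ≤ 1) (hyb : ¬ rk M {s₁, y} ≤ 1) :
    rk M {z, y} = 2 := by
  have h := rk_insert_eq_of_parallel hll hz hs₁ (by rw [pair_comm]; exact hzb)
    (X := {y}) (singleton_subset_iff.2 hy)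
  have h2 : rk M {s₁, y} ≤ 2 := (rk_le_card _).trans card_le_two
  rw [h]
  omega

/-- **The count when `S` has a parallel pair `{s₁, s₂}`** (`#Y ≥ 3`). -/
theorem one_add_three_mul_card_le_card_spanning_five_of_parallel_pair (hR : rk M (gr M) = 4)
    (hll : ∀ x ∈ gr M, rk M {x} = 1) {S Y : Finset α} (hS : S ⊆ gr M) (hS5 : S.card = 5) (hSsp : rk M S = 4)
    (hY : Y ⊆ gr M \ S) (hY3 : 3 ≤ Y.card) {s₁ s₂ : α} (hs₁ : s₁ ∈ S) (hs₂ : s₂ ∈ S) (hne : s₁ ≠ s₂)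
    (hpar : rk M {s₁, s₂} ≤ 1) :
    1 + 3 * Y.card + 3 * ((Y.powersetCard 2).filter (fun Z => rk M Z = 2)).card +
      ((Y.powersetCard 3).filter (fun Z => rk M Z = 3)).card ≤
      (((S ∪ Y).powersetCard 5).filter (fun X => rk M X = 4)).card := by
  have hYg : Y ⊆ gr M := hY.trans sdiff_subset
  have hSY : Disjoint S Y := by
    rw [disjoint_left]
    intro x hxS hxY
    exact (mem_sdiff.1 (hY hxY)).2 hxS
  have hs₁g : s₁ ∈ gr M := hS hs₁
  have hsum := sum_card_filter_le_card_spanning_five (M := M) hS5 hSY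
  rw [sum_range_four_eq hSsp] at hsum
  -- the bad points
  set P := Y.filter (fun y => rk M {s₁, y} ≤ 1) with hPdef
  have hPY : P ⊆ Y := filter_subset _ _
  have hmemP : ∀ y ∈ Y, y ∉ P → ¬ rk M {s₁, y} ≤ 1 := by
    intro y hy hyP h
    exact hyP (mem_filter.2 ⟨hy, h⟩)
  -- (1) the point labels: `Σ_y a(y) + b ≥ 3 #Y`
  have h1 : 3 * Y.card ≤ (∑ y ∈ Y, (S.filter (fun s => rk M (insert y (S.erase s)) = 4)).card) + P.card := by
    have e : P.card = ∑ y ∈ Y, if rk M {s₁, y} ≤ 1 then 1 else 0 := card_filter _ _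
    rw [e, ← sum_add_distrib]
    have hle : ∑ _y ∈ Y, (3 : ℕ) ≤ ∑ y ∈ Y,
        ((S.filter (fun s => rk M (insert y (S.erase s)) = 4)).card + if rk M {s₁, y} ≤ 1 then 1 else 0) := by
      apply sum_le_sum
      intro y hy
      have hyg := (mem_sdiff.1 (hY hy)).1
      split_ifs with h
      · have := two_le_card_filter_of_parallel_pair hR hll hS hSsp hs₁ hs₂ hne hpar hyg
        omega
      · have := three_le_card_filter_of_parallel_pair_of_not hR hll hS hS5 hSsp hs₁ hs₂ hne hpar hyg h
        omega
    rw [sum_const, smul_eq_mul] at hle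
    omega
  -- (2) the pair labels, pointwise: `g(Z) ≥ 3·[Z independent] + [Z ⊆ P]`
  have hpt2 : ∀ Z ∈ Y.powersetCard 2, (3 * (if rk M Z = 2 then 1 else 0) + if Z ⊆ P then 1 else 0) ≤
      ((S.powersetCard 2).filter (fun A => rk M ((S \ A) ∪ Z) = 4)).card := by
    intro Z hZ
    rw [mem_powersetCard] at hZ
    obtain ⟨z, z', hzz', hZeq⟩ := card_eq_two.1 hZ.2
    have hzZ : z ∈ Z := by rw [hZeq]; exact mem_insert_self _ _
    have hz'Z : z' ∈ Z := by rw [hZeq]; exact mem_insert_of_mem (mem_singleton_self _)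
    split_ifs with h2 hP hP
    · exfalso
      have hz := mem_filter.1 (hP hzZ)
      have hz' := mem_filter.1 (hP hz'Z)
      have := rk_pair_le_one_of_bad hll hs₁g (hYg hz.1) (hYg hz'.1) hz.2 hz'.2
      rw [hZeq] at h2
      omega
    · have := succ_card_le_card_filter_of_indep hR hS hS5 hSsp hY hZ.1 (by omega) (by rw [h2, hZ.2])
      rw [hZ.2] at this
      omega
    · have hz := mem_filter.1 (hP hzZ)
      have hz' := mem_filter.1 (hP hz'Z)
      have := one_le_card_filter_pair_of_bad hR hll hS hSsp hs₁ hs₂ hne hpar (hYg hz.1) (hYg hz'.1) hz.2 hz'.2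
      rw [hZeq]
      omega
    · omega
  have h2sum : 3 * ((Y.powersetCard 2).filter (fun Z => rk M Z = 2)).card + P.card.choose 2 =
      ∑ Z ∈ Y.powersetCard 2, (3 * (if rk M Z = 2 then 1 else 0) + if Z ⊆ P then 1 else 0) := by
    have e : (Y.powersetCard 2).filter (fun Z => Z ⊆ P) = P.powersetCard 2 := by
      ext Z
      rw [mem_filter, mem_powersetCard, mem_powersetCard]
      constructor
      · rintro ⟨⟨_, h2⟩, hZP⟩
        exact ⟨hZP, h2⟩
      · rintro ⟨hZP, h2⟩
        exact ⟨⟨hZP.trans hPY, h2⟩, hZP⟩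
    rw [sum_add_distrib, ← mul_sum, ← card_filter, ← card_filter, e, card_powersetCard]
  -- (3) the triple labels, pointwise: `g(Z) ≥ [Z independent]`
  have hpt3 : ∀ Z ∈ Y.powersetCard 3, (if rk M Z = 3 then 1 else 0) ≤
      ((S.powersetCard 3).filter (fun A => rk M ((S \ A) ∪ Z) = 4)).card := by
    intro Z hZ
    rw [mem_powersetCard] at hZ
    split_ifs with h
    · have := succ_card_le_card_filter_of_indep hR hS hS5 hSsp hY hZ.1 (by omega) (by rw [h, hZ.2])
      rw [hZ.2] at this
      omega
    · omega
  have h3sum : ((Y.powersetCard 3).filter (fun Z => rk M Z = 3)).card =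
      ∑ Z ∈ Y.powersetCard 3, (if rk M Z = 3 then 1 else 0) := card_filter _ _
  have h2basic := (le_of_eq h2sum).trans (sum_le_sum hpt2)
  have h3basic := (le_of_eq h3sum).trans (sum_le_sum hpt3)
  -- the cases on `b = #P`
  obtain hb0 | hb1 | hb2 | hb3 : P.card = 0 ∨ P.card = 1 ∨ P.card = 2 ∨ 3 ≤ P.card := by omega
  · -- no bad point
    rw [hb0] at h1
    omega
  · -- one bad point `z`; two non-bad points `y ≠ y'`
    obtain ⟨z, hPz⟩ := card_eq_one.1 hb1
    have hzP : z ∈ P := by rw [hPz]; exact mem_singleton_self z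
    have hzY : z ∈ Y := hPY hzP
    have hzg : z ∈ gr M := hYg hzY
    have hzb : rk M {s₁, z} ≤ 1 := (mem_filter.1 hzP).2
    have hrest : 1 < (Y \ P).card := by
      rw [card_sdiff_of_subset hPY, hb1]
      omega
    obtain ⟨y, hy, y', hy', hyy'⟩ := one_lt_card.1 hrest
    rw [mem_sdiff] at hy hy'
    have hyb := hmemP y hy.1 hy.2
    have hy'b := hmemP y' hy'.1 hy'.2
    have hyg : y ∈ gr M := hYg hy.1
    have hy'g : y' ∈ gr M := hYg hy'.1
    have hzy : z ≠ y := fun h => hy.2 (h ▸ hzP)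
    have hzy' : z ≠ y' := fun h => hy'.2 (h ▸ hzP)
    rw [hb1, Nat.choose_succ_self] at h2basic
    by_cases hw : ∃ w ∈ Y, w ∉ P ∧ 1 < ((S \ {s₁, s₂}).filter
        (fun m => rk M (insert w (insert s₁ ((S \ {s₁, s₂}).erase m))) = 4)).card
    · -- a non-bad `w` off two hyperplanes: the pair `{z, w}` has five labels
      obtain ⟨w, hwY, hwP, hwF⟩ := hw
      have hwb := hmemP w hwY hwP
      have hwg : w ∈ gr M := hYg hwY
      have hzw : z ≠ w := fun h => hwP (h ▸ hzP)
      obtain ⟨m, hm, m', hm', hmm'⟩ := one_lt_card.1 hwF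
      rw [mem_filter] at hm hm'
      have hZ0 : ({z, w} : Finset α) ∈ Y.powersetCard 2 := by
        rw [mem_powersetCard]
        exact ⟨insert_subset hzY (singleton_subset_iff.2 hwY), card_pair hzw⟩
      have hZg : ({z, w} : Finset α) ⊆ gr M := insert_subset hzg (singleton_subset_iff.2 hwg)
      have hfive := five_le_card_filter_pair_of_witnesses hR hll hS hs₁ hs₂ hne hpar hm.1 hm'.1 hmm' hZg
        (rk_insert_erase_union_eq_four hR hS hs₁ hm.2 hZg (mem_insert_of_mem (mem_singleton_self w)))
        (rk_insert_erase_union_eq_four hR hS hs₁ hm'.2 hZg (mem_insert_of_mem (mem_singleton_self w)))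
        (rk_sdiff_pair_union_pair_eq_four hR hll hS hSsp hs₁ hs₂ hpar hzg hwg hzb)
      have hind := rk_pair_eq_two_of_bad_of_not hll hs₁g hzg hwg hzb hwb
      have hnotP : ¬ ({z, w} : Finset α) ⊆ P := fun h => hwP (h (mem_insert_of_mem (mem_singleton_self w)))
      have hextra := sum_add_le_sum_of_le_of_add_le hpt2 hZ0 (c := 2) (by
        rw [if_pos hind, if_neg hnotP]
        omega)
      rw [← h2sum, hb1, Nat.choose_succ_self] at hextra
      omega
    · -- every non-bad point lies on a single line `cl{s₁, m}`
      simp only [not_exists, not_and, not_lt] at hw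
      have hline : ∀ w ∈ Y, w ∉ P → ∃ m ∈ S \ {s₁, s₂},
          rk M (insert w (insert s₁ ((S \ {s₁, s₂}).erase m))) = 4 ∧ rk M (insert w {s₁, m}) ≤ 2 := by
        intro w hwY hwP
        have hwb := hmemP w hwY hwP
        obtain ⟨m, hm, hm4⟩ := exists_mem_sdiff_rk_insert_eq_four hR hll hS hS5 hSsp hs₁ hs₂ hne hpar
          (hYg hwY) hwb
        refine ⟨m, hm, hm4, ?_⟩
        apply rk_insert_pair_le_two_of_unique hR hll hS hS5 hSsp hs₁ hs₂ hne hpar hm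
        intro k hk hkm
        have hle := hw w hwY hwP
        have h4 : rk M (insert w (insert s₁ ((S \ {s₁, s₂}).erase k))) ≤ rk M (gr M) :=
          rk_le_rk_gr (insert_subset (hYg hwY) (insert_subset hs₁g
            ((erase_subset _ _).trans ((sdiff_subset (s := S) (t := {s₁, s₂})).trans hS))))
        by_contra hcon
        have hk4 : rk M (insert w (insert s₁ ((S \ {s₁, s₂}).erase k))) = 4 := by omega
        have hsub : ({m, k} : Finset α) ⊆ (S \ {s₁, s₂}).filter
            (fun m => rk M (insert w (insert s₁ ((S \ {s₁, s₂}).erase m))) = 4) := by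
          rw [insert_subset_iff, singleton_subset_iff, mem_filter, mem_filter]
          exact ⟨⟨hm, hm4⟩, ⟨hk, hk4⟩⟩
        have := card_le_card hsub
        rw [card_pair hkm.symm] at this
        omega
      obtain ⟨m, hm, hym, hy2⟩ := hline y hy.1 hy.2
      obtain ⟨m', hm', hy'm', hy'2⟩ := hline y' hy'.1 hy'.2
      by_cases hmm' : m = m'
      · -- one line: the dependent triple `{z, y, y'}` has a label
        subst hmm'
        have hZ0 : ({z, y, y'} : Finset α) ∈ Y.powersetCard 3 := by
          rw [mem_powersetCard]
          refine ⟨insert_subset hzY (insert_subset hy.1 (singleton_subset_iff.2 hy'.1)), ?_⟩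
          rw [card_insert_of_notMem, card_pair hyy']
          rw [mem_insert, mem_singleton, not_or]
          exact ⟨hzy, hzy'⟩
        have hZg : ({z, y, y'} : Finset α) ⊆ gr M :=
          insert_subset hzg (insert_subset hyg (singleton_subset_iff.2 hy'g))
        have hdep := rk_triple_le_two_of_same_line hll hs₁g hzg hyg hy'g hzb
          (rk_insert_pair_le_two_of_same_line hR hll hS hS5 hSsp hs₁ hs₂ hne hpar hm hy2 hy'2)
        have hone := one_le_card_filter_triple_of_bad_mem hR hll hS hs₁ hs₂ hne hzg hzb hm hym hZg
          (mem_insert_self _ _) (mem_insert_of_mem (mem_insert_self _ _))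
        have hextra := sum_add_le_sum_of_le_of_add_le hpt3 hZ0 (c := 1) (by
          rw [if_neg (by omega)]
          omega)
        rw [← h3sum] at hextra
        omega
      · -- two lines: the independent pair `{y, y'}` has four labels
        have hZ0 : ({y, y'} : Finset α) ∈ Y.powersetCard 2 := by
          rw [mem_powersetCard]
          exact ⟨insert_subset hy.1 (singleton_subset_iff.2 hy'.1), card_pair hyy'⟩
        have hZg : ({y, y'} : Finset α) ⊆ gr M := insert_subset hyg (singleton_subset_iff.2 hy'g)
        have hind := rk_pair_eq_two_of_different_lines hR hll hS hS5 hSsp hs₁ hs₂ hne hpar hyg hy'g hm hm'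
          hmm' hy2 hy'2 hy'b
        have hfour := four_le_card_filter_pair_of_witnesses hR hll hS hs₁ hs₂ hne hpar hm hm' hmm' hZg
          (rk_insert_erase_union_eq_four hR hS hs₁ hym hZg (mem_insert_self _ _))
          (rk_insert_erase_union_eq_four hR hS hs₁ hy'm' hZg (mem_insert_of_mem (mem_singleton_self y')))
        have hnotP : ¬ ({y, y'} : Finset α) ⊆ P := fun h => hy.2 (h (mem_insert_self _ _))
        have hextra := sum_add_le_sum_of_le_of_add_le hpt2 hZ0 (c := 1) (by
          rw [if_pos hind, if_neg hnotP]
          omega)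
        rw [← h2sum, hb1, Nat.choose_succ_self] at hextra
        omega
  · -- two bad points `z ≠ z'`; a non-bad `y`: the dependent triple `{z, z', y}` has a label
    obtain ⟨z, z', hzz', hPeq⟩ := card_eq_two.1 hb2
    have hzP : z ∈ P := by rw [hPeq]; exact mem_insert_self _ _
    have hz'P : z' ∈ P := by rw [hPeq]; exact mem_insert_of_mem (mem_singleton_self _)
    have hzb : rk M {s₁, z} ≤ 1 := (mem_filter.1 hzP).2
    have hz'b : rk M {s₁, z'} ≤ 1 := (mem_filter.1 hz'P).2
    have hzg : z ∈ gr M := hYg (hPY hzP)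
    have hz'g : z' ∈ gr M := hYg (hPY hz'P)
    obtain ⟨y, hyY, hyP⟩ := exists_mem_notMem_of_card_lt_card (show P.card < Y.card by omega)
    have hyb := hmemP y hyY hyP
    have hyg : y ∈ gr M := hYg hyY
    obtain ⟨m, hm, hym⟩ := exists_mem_sdiff_rk_insert_eq_four hR hll hS hS5 hSsp hs₁ hs₂ hne hpar hyg hyb
    have hZ0 : ({z, z', y} : Finset α) ∈ Y.powersetCard 3 := by
      rw [mem_powersetCard]
      refine ⟨insert_subset (hPY hzP) (insert_subset (hPY hz'P) (singleton_subset_iff.2 hyY)), ?_⟩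
      rw [card_insert_of_notMem, card_pair (fun h => hyP (by rw [← h]; exact hz'P))]
      rw [mem_insert, mem_singleton, not_or]
      exact ⟨hzz', fun h => hyP (by rw [← h]; exact hzP)⟩
    have hZg : ({z, z', y} : Finset α) ⊆ gr M :=
      insert_subset hzg (insert_subset hz'g (singleton_subset_iff.2 hyg))
    have hdep := rk_triple_le_two_of_two_bad hll hs₁g hzg hz'g hyg hzb hz'b
    have hone := one_le_card_filter_triple_of_bad_mem hR hll hS hs₁ hs₂ hne hzg hzb hm hym hZg
      (mem_insert_self _ _) (mem_insert_of_mem (mem_insert_of_mem (mem_singleton_self _)))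
    have hextra := sum_add_le_sum_of_le_of_add_le hpt3 hZ0 (c := 1) (by
      rw [if_neg (by omega)]
      omega)
    rw [← h3sum] at hextra
    rw [hb2, Nat.choose_self] at h2basic
    omega
  · -- three or more bad points: `C(b, 2) ≥ b`
    have hch : P.card ≤ P.card.choose 2 := by
      rw [Nat.choose_two_right, Nat.le_div_iff_mul_le (by norm_num)]
      have : 2 ≤ P.card - 1 := by omega
      calc P.card * 2 ≤ P.card * (P.card - 1) := Nat.mul_le_mul_left _ this
        _ = _ := rfl
    omega

/-- **THE COUNT** (`(***)` of §59 ADDENDUM 4 in the dual): in a loopless matroid of rank `4`, for a spanning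
`5`-set `S` and a set `Y` of at least three further points,
`1 + 3·#Y + 3·ι₂(Y) + ι₃(Y) ≤ #{X ∈ C(S ∪ Y, 5) : X spans}`. -/
theorem one_add_three_mul_card_le_card_spanning_five (hR : rk M (gr M) = 4) (hll : ∀ x ∈ gr M, rk M {x} = 1)
    {S Y : Finset α} (hS : S ⊆ gr M) (hS5 : S.card = 5) (hSsp : rk M S = 4) (hY : Y ⊆ gr M \ S)
    (hY3 : 3 ≤ Y.card) :
    1 + 3 * Y.card + 3 * ((Y.powersetCard 2).filter (fun Z => rk M Z = 2)).card +
      ((Y.powersetCard 3).filter (fun Z => rk M Z = 3)).card ≤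
      (((S ∪ Y).powersetCard 5).filter (fun X => rk M X = 4)).card := by
  by_cases hpp : ∃ t ∈ S, ∃ t' ∈ S, t ≠ t' ∧ rk M {t, t'} ≤ 1
  · obtain ⟨s₁, hs₁, s₂, hs₂, hne, hpar⟩ := hpp
    exact one_add_three_mul_card_le_card_spanning_five_of_parallel_pair hR hll hS hS5 hSsp hY hY3 hs₁ hs₂
      hne hpar
  · exact one_add_three_mul_card_le_card_spanning_five_of_no_parallel_pair hR hS hS5 hSsp hY hpp

end StarStarE

end PercRepro.Cogirth
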